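import Summits.QuantumFields.YangMills.Theorems.UnitScaleTiltProp7SectET3OpsT3ReadingRows
import Summits.QuantumFields.YangMills.Theorems.UnitScaleTiltProp7SectET3RealCoordSums
import Literature.MathematicalPhysics.QuantumFieldTheory.Balaban1983to89.B9Thm311ReadingCoords
import HarnessLib

/-!
# Route `UnitScaleTilt` (α), node N06(d = 3), layer 0 ∕ brick L0f — **THE LAYER-0 LETTERS READ ON THE ROUTE CARRIERS, IN pub-ymgap's «GENUINE CURRENCY»**: the operator identities
# of ✓ `Prop7SectET3OpsT3HilbertRows` transported to ym-inputs-p01's route carriers `PBond (F.P K) 0 → M₂(ℂ)` ∕ `PBond (F.P n) 0 → M₂(ℂ)` ∕ `Site (F.P K) 0 → M₂(ℂ)` (his `…Pi`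
# read-back convention), and the symmetry ∕ adjointness ∕ positivity of those read-backs for n06-j's weighted real trace pairing `B9Thm311ReadingCoords.trIP` (`IsSymmTr`, `IsAdjTr`,
# `PosDefTr`) — i.e. EVERY hypothesis of ✓ `Prop7SectET3OpsCoordPins.identities_of_coordPins` ∕ `letterSymm_of_coordPins` ∕ `posDefEnd_of_coordPin` (the κ-fold pins of memo
# `L0F-DEF-DESIGN-p05g2.md` §5) at the T³ member, modulo ONLY the class `PosOnto` (three slots) and the slot facts `hΔ`∕`hΔs`

Cell `ym-inputs` (D-0154 (2); desk `ym-inputs-plan-1` INPUT-LIST v8 §4 row p05; this seat's memo `L0F-DEF-DESIGN-p05g2.md` §5 (20520 evidence)), seat ym-inputs-p05 g2.  Count-neutral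
helper (`--supports stmt-QuantumFields-20520 --as helper`; RULING g26-№2); registry untouched; THEOREMS ONLY (0 `def`, 0 `sorry`) — the read-backs are written as explicit composites
`(toL2 F K c₀).symm ∘ₗ T ∘ₗ (toL2 F K c₀)` (no new letter is named; the definer's `…Pi` defs, when they come, are these terms).  NOTHING of [Balaban1985BackgroundPropagators] is asserted.

WHAT IS PROVED (ns `…Theorems.Prop7SectET3OpsT3CarrierRows`; member `F`, `h : n ≤ K`, parameters `c₀ cB a`, slots `Δx Δ0x Δπx Δ1x`):
* §1 THE PAIRING DICTIONARY: `re_inner_toL2_eq_trIP` (`re ⟪toL2 A, toL2 B⟫_ℂ = trIP (fun _ ↦ c₀) A B`), `re_inner_toL2S_eq_trIP`, `re_inner_toL2B_eq_trIP` (`cB`); `trIP_const_eq_mul`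
  (`trIP (fun _ ↦ c) = c · trIP (fun _ ↦ 1)`).
* §2 GENUINE-CURRENCY ROWS OF THE READ-BACKS: ★ `isSymmTr_readback` (`T` symmetric on `L²` ⇒ `IsSymmTr (fun _ ↦ 1) (toL2⁻¹ T toL2)` — for `laplaceA Δx` via ✓`laplaceA_isSymmetric`,
  for `GT Δx` via ✓`GT_isSymmetric`, for the slot differences), ★ `isAdjTr_readback_Qk` (`IsAdjTr (fun _ ↦ c₀) (fun _ ↦ cB) (toL2B⁻¹ Q_k toL2) (toL2⁻¹ Q_k† toL2B)` — print's weights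
  HONESTLY, plus the weight-one corollary `isAdjTr_one_readback_Qk` with the factor `c₀∕cB` on `Q_k†`), ★ `isAdjTr_readback_DL2` (`IsAdjTr 1 1 (toL2⁻¹ D toL2S) (toL2S⁻¹ D* toL2)`, equal
  weights), ★ `posDefTr_readback_laplaceA` (`PosDefTr (fun _ ↦ 1) (toL2⁻¹ Δ_a toL2)` ⇐ `PosOnto.pos`).
* §3 THE TEN OPERATOR IDENTITIES ON THE ROUTE CARRIER (`invG0'`∕`invG`∕`invG1`∕`eq126`∕`eq129`∕`eq153`∕`c1_inv`∕`h124Q`∕`h124R`∕`hR` shapes of ✓`identities_of_coordPins`), each ✓A's row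
  transported by ✓`Prop7SectET3OpsT3ReadingRows.transport_comp_transport`∕`_id`∕`_zero`∕`_sub`∕`_add`.
HONEST SCOPE: bookkeeping; positivity ∕ onto-ness NOT proved (the class); `hΔ`∕`hΔs` are p01's slot rows; the PINS themselves (which read-back feeds which `Ops` field, `b := trBasis 2`,
`c := cR39 (trBasis 2)`, the weight convention for `Q_k†`) are the definer's; N06(d = 3) NOT discharged; no summit∕sub-problem claim; rung R3, not Clay.

References: T. Bałaban, CMP **99** (1985) 389–434 [Balaban1985BackgroundPropagators] (p.391, p.393 scalar products; (3.26)–(3.27) p.395; (3.120)–(3.130) pp.419–421; (3.124) p.420;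
(3.147) p.425; (3.153) p.426; Thm 3.11 p.416).
-/

set_option autoImplicit false

noncomputable section

open scoped InnerProductSpace ComplexConjugate Matrix Matrix.Norms.L2Operator

namespace Summit.QuantumFields.YangMills.Theorems.Prop7SectET3OpsT3CarrierRows

open Literature.MathematicalPhysics.QuantumFieldTheory.Balaban1983to89
open Literature.MathematicalPhysics.QuantumFieldTheory.Balaban1983to89.T3ContinuumYM3Torus
open B9Eq311L2Pairing (WL2)
open B11Eq103H1Complex (SiteL2K BondL2K)
open B9Thm311ReadingCoords (trIP trIP_eq_re_trace IsSymmTr IsAdjTr PosDefTr)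
open Summit.QuantumFields.YangMills.Theorems.Prop7SectET3Transport (periodsT3)
open Summit.QuantumFields.YangMills.Theorems.Prop7SectET3HilbertLetters (W₂ toL2 toL2S toL2B QL2 DL2 DstarL2 inner_toL2 inner_toL2B)
open Summit.QuantumFields.YangMills.Theorems.Prop7SectET3GaugeProjector (RS NS)
open Summit.QuantumFields.YangMills.Theorems.Prop7SectET3CurvedPropagators (Qk laplaceA PosOnto GT KinvT HT frakGT HT_eq_comp)
open Summit.QuantumFields.YangMills.Theorems.Prop7SectET3OpsT3HilbertRows (GT_comp_laplaceA invG_row invG1_row c1_inv_row frakGT_eq h124Q_row hR_row h124R_row laplaceA_isSymmetric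
  GT_isSymmetric sub_slot_isSymmetric inner_Qk_left inner_DL2_left inner_RS_left)
open Summit.QuantumFields.YangMills.Theorems.Prop7SectET3OpsT3ReadingRows (transport_comp_transport transport_id transport_zero transport_sub transport_add)
open Summit.QuantumFields.YangMills.Theorems.Prop7SectET3RealCoordSums (inner_toL2S)

variable {F : T3Family} {n K : ℕ} {h : n ≤ K} {c₀ cB a : ℝ} [Fact (0 < c₀)] [Fact (0 < cB)]
  {Δx Δ0x Δπx Δ1x : GaugeField (F.P K) 0 (Matrix.specialUnitaryGroup (Fin 2) ℂ) → (BondL2K ℂ 3 (periodsT3 F K) c₀ W₂ →ₗ[ℂ] BondL2K ℂ 3 (periodsT3 F K) c₀ W₂)}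

/-! ## §1 The pairing dictionary: `L²` inner products vs the weighted real trace pairing -/

/-- a constant weight comes out: `trIP (fun _ ↦ c) Φ Ψ = c · trIP (fun _ ↦ 1) Φ Ψ`. [folklore] -/
theorem trIP_const_eq_mul {S m : Type} [Fintype S] [Fintype m] (c : ℝ) (Φ Ψ : S → Matrix m m ℂ) :
    trIP (fun _ => c) Φ Ψ = c * trIP (fun _ => (1 : ℝ)) Φ Ψ := by
  unfold trIP
  rw [Finset.mul_sum]
  exact Finset.sum_congr rfl fun s _ => by rw [one_mul]

omit [Fact (0 < cB)] in
/-- **THE FINE PAIRING IS THE `c₀`-WEIGHTED TRACE PAIRING**: `re ⟪toL2 A, toL2 B⟫_ℂ = trIP (fun _ ↦ c₀) A B`. [cite: Balaban1985BackgroundPropagators, (3.11) p.392, p.393] -/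
theorem re_inner_toL2_eq_trIP (A B : PBond (F.P K) 0 → Matrix (Fin 2) (Fin 2) ℂ) :
    (⟪toL2 F K c₀ A, toL2 F K c₀ B⟫_ℂ).re = trIP (fun _ => c₀) A B := by
  rw [inner_toL2, Complex.re_ofReal_mul, Complex.re_sum, trIP_eq_re_trace, Finset.mul_sum]

omit [Fact (0 < cB)] in
/-- **THE SITE PAIRING IS THE `c₀`-WEIGHTED TRACE PAIRING**: `re ⟪toL2S λ, toL2S μ⟫_ℂ = trIP (fun _ ↦ c₀) λ μ`. [cite: Balaban1985BackgroundPropagators, p.393] -/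
theorem re_inner_toL2S_eq_trIP (l l' : Site (F.P K) 0 → Matrix (Fin 2) (Fin 2) ℂ) :
    (⟪toL2S F K c₀ l, toL2S F K c₀ l'⟫_ℂ).re = trIP (fun _ => c₀) l l' := by
  rw [inner_toL2S, Complex.re_ofReal_mul, Complex.re_sum, trIP_eq_re_trace, Finset.mul_sum]

omit [Fact (0 < c₀)] in
/-- **THE BLOCK PAIRING IS THE `cB`-WEIGHTED TRACE PAIRING**: `re ⟪toL2B B, toL2B B′⟫_ℂ = trIP (fun _ ↦ cB) B B′`. [cite: Balaban1985BackgroundPropagators, (3.16) p.393] -/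
theorem re_inner_toL2B_eq_trIP (B B' : PBond (F.P n) 0 → Matrix (Fin 2) (Fin 2) ℂ) :
    (⟪toL2B F n cB B, toL2B F n cB B'⟫_ℂ).re = trIP (fun _ => cB) B B' := by
  rw [inner_toL2B, Complex.re_ofReal_mul, Complex.re_sum, trIP_eq_re_trace, Finset.mul_sum]

/-! ## §2 Symmetry, adjointness and positivity of the read-backs in genuine currency -/

omit [Fact (0 < cB)] in
/-- ★ **A SYMMETRIC `L²` LETTER READS BACK TO A TRACE-SYMMETRIC LETTER ON THE ROUTE CARRIER**: `T.IsSymmetric ⇒ IsSymmTr (fun _ ↦ 1) (toL2⁻¹ ∘ T ∘ toL2)` (the constant weight `c₀`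
cancels) — for `Δ_a` (✓`laplaceA_isSymmetric`), `G` (✓`GT_isSymmetric`), `Δ′_π = Δ0x − Δπx`, `Δ⁽²⁾_π` (✓`sub_slot_isSymmetric`). [cite: Balaban1985BackgroundPropagators, Thm 3.11 p.416 («symmetric»), p.391] -/
theorem isSymmTr_readback {T : BondL2K ℂ 3 (periodsT3 F K) c₀ W₂ →ₗ[ℂ] BondL2K ℂ 3 (periodsT3 F K) c₀ W₂} (hT : T.IsSymmetric) :
    IsSymmTr (fun _ => (1 : ℝ)) ((toL2 F K c₀).symm.toLinearMap ∘ₗ T ∘ₗ (toL2 F K c₀).toLinearMap) := by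
  intro Φ Ψ
  have hc : (c₀ : ℝ) ≠ 0 := (Fact.out : 0 < c₀).ne'
  have h1 := re_inner_toL2_eq_trIP (c₀ := c₀) ((toL2 F K c₀).symm (T (toL2 F K c₀ Φ))) Ψ
  have h2 := re_inner_toL2_eq_trIP (c₀ := c₀) Φ ((toL2 F K c₀).symm (T (toL2 F K c₀ Ψ)))
  rw [LinearEquiv.apply_symm_apply] at h1 h2
  rw [trIP_const_eq_mul] at h1 h2
  have h12 : (⟪T (toL2 F K c₀ Φ), toL2 F K c₀ Ψ⟫_ℂ).re = (⟪toL2 F K c₀ Φ, T (toL2 F K c₀ Ψ)⟫_ℂ).re := by rw [hT]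
  simp only [LinearMap.coe_comp, LinearEquiv.coe_coe, Function.comp_apply]
  exact mul_left_cancel₀ hc (by rw [← h1, ← h2, h12])

/-- ★ **`Q_k†` IS THE ADJOINT OF `Q_k` IN PRINT'S WEIGHTS ON THE ROUTE CARRIERS**: `IsAdjTr (fun _ ↦ c₀) (fun _ ↦ cB) (toL2B⁻¹ Q_k toL2) (toL2⁻¹ Q_k† toL2B)`.
[cite: Balaban1985BackgroundPropagators, p.391, (3.16) p.393] -/
theorem isAdjTr_readback_Qk (U₀ : GaugeField (F.P K) 0 (Matrix.specialUnitaryGroup (Fin 2) ℂ)) :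
    IsAdjTr (fun _ => c₀) (fun _ => cB) ((toL2B F n cB).symm.toLinearMap ∘ₗ Qk F n K h c₀ cB U₀ ∘ₗ (toL2 F K c₀).toLinearMap)
      ((toL2 F K c₀).symm.toLinearMap ∘ₗ LinearMap.adjoint (Qk F n K h c₀ cB U₀) ∘ₗ (toL2B F n cB).toLinearMap) := by
  intro Φ Ψ
  simp only [LinearMap.coe_comp, LinearEquiv.coe_coe, Function.comp_apply]
  rw [← re_inner_toL2B_eq_trIP, ← re_inner_toL2_eq_trIP, LinearEquiv.apply_symm_apply, LinearEquiv.apply_symm_apply, inner_Qk_left]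

/-- the weight-one form ✓`identities_of_coordPins` consumes: `IsAdjTr 1 1 (toL2B⁻¹ Q_k toL2) ((c₀∕cB) • toL2⁻¹ Q_k† toL2B)` (print's two weights as one factor on `Q_k†`; `= 1` at
`cB := c₀`). [cite: Balaban1985BackgroundPropagators, p.391, (3.16) p.393] -/
theorem isAdjTr_one_readback_Qk (U₀ : GaugeField (F.P K) 0 (Matrix.specialUnitaryGroup (Fin 2) ℂ)) :
    IsAdjTr (fun _ => (1 : ℝ)) (fun _ => (1 : ℝ)) ((toL2B F n cB).symm.toLinearMap ∘ₗ Qk F n K h c₀ cB U₀ ∘ₗ (toL2 F K c₀).toLinearMap)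
      ((((c₀ / cB : ℝ) : ℂ)) • ((toL2 F K c₀).symm.toLinearMap ∘ₗ LinearMap.adjoint (Qk F n K h c₀ cB U₀) ∘ₗ (toL2B F n cB).toLinearMap)) := by
  intro Φ Ψ
  have hB : (cB : ℝ) ≠ 0 := (Fact.out : 0 < cB).ne'
  have hw := isAdjTr_readback_Qk (h := h) (c₀ := c₀) (cB := cB) U₀ Φ Ψ
  rw [trIP_const_eq_mul, trIP_const_eq_mul (c := c₀)] at hw
  have hs : ∀ (X Y : PBond (F.P K) 0 → Matrix (Fin 2) (Fin 2) ℂ) (r : ℝ), trIP (fun _ => (1 : ℝ)) X (((r : ℝ) : ℂ) • Y) = r * trIP (fun _ => (1 : ℝ)) X Y := by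
    intro X Y r
    rw [trIP_eq_re_trace, trIP_eq_re_trace, Finset.mul_sum]
    refine Finset.sum_congr rfl fun s _ => ?_
    rw [Pi.smul_apply, Matrix.mul_smul, Matrix.trace_smul, smul_eq_mul, Complex.re_ofReal_mul, one_mul, one_mul]
  rw [LinearMap.smul_apply, hs, div_mul_eq_mul_div, eq_div_iff hB, mul_comm _ cB, hw]

omit [Fact (0 < cB)] in
/-- ★ **`D*` IS THE ADJOINT OF `D` ON THE ROUTE CARRIERS, EQUAL WEIGHTS**: `IsAdjTr 1 1 (toL2⁻¹ D toL2S) (toL2S⁻¹ D* toL2)` (✓`adjoint_DL2`; the common weight `c₀` cancels).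
[cite: Balaban1985BackgroundPropagators, (3.8) p.392] -/
theorem isAdjTr_readback_DL2 (U₀ : GaugeField (F.P K) 0 (Matrix.specialUnitaryGroup (Fin 2) ℂ)) :
    IsAdjTr (fun _ => (1 : ℝ)) (fun _ => (1 : ℝ)) ((toL2 F K c₀).symm.toLinearMap ∘ₗ DL2 F n K c₀ U₀ ∘ₗ (toL2S F K c₀).toLinearMap)
      ((toL2S F K c₀).symm.toLinearMap ∘ₗ DstarL2 F n K c₀ U₀ ∘ₗ (toL2 F K c₀).toLinearMap) := by
  intro Φ Ψ
  have hc : (c₀ : ℝ) ≠ 0 := (Fact.out : 0 < c₀).ne'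
  simp only [LinearMap.coe_comp, LinearEquiv.coe_coe, Function.comp_apply]
  apply mul_left_cancel₀ hc
  rw [← trIP_const_eq_mul, ← trIP_const_eq_mul, ← re_inner_toL2_eq_trIP, ← re_inner_toL2S_eq_trIP, LinearEquiv.apply_symm_apply, LinearEquiv.apply_symm_apply,
    inner_DL2_left]

omit [Fact (0 < cB)] in
/-- ★ **`R_S` READ BACK IS TRACE-SYMMETRIC** (equal weights; ✓`inner_RS_left`) — p01's `RSPi` is this composite. [cite: Balaban1985BackgroundPropagators, (3.21) p.394] -/
theorem isSymmTr_readback_RS [Fact (0 < cB)] (U₀ : GaugeField (F.P K) 0 (Matrix.specialUnitaryGroup (Fin 2) ℂ)) :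
    IsSymmTr (fun _ => (1 : ℝ)) ((toL2S F K c₀).symm.toLinearMap ∘ₗ RS F n K h c₀ cB U₀ ∘ₗ (toL2S F K c₀).toLinearMap) := by
  intro Φ Ψ
  have hc : (c₀ : ℝ) ≠ 0 := (Fact.out : 0 < c₀).ne'
  simp only [LinearMap.coe_comp, LinearEquiv.coe_coe, Function.comp_apply]
  apply mul_left_cancel₀ hc
  rw [← trIP_const_eq_mul, ← trIP_const_eq_mul, ← re_inner_toL2S_eq_trIP, ← re_inner_toL2S_eq_trIP, LinearEquiv.apply_symm_apply, LinearEquiv.apply_symm_apply, inner_RS_left]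

/-- ★ **`Δ_a` READ BACK IS TRACE-POSITIVE ON THE CLASS**: `PosOnto … Δx U₀ ⇒ PosDefTr (fun _ ↦ 1) (toL2⁻¹ Δ_a toL2)` (Theorem 3.11's conclusion, displayed as the class).
[cite: Balaban1985BackgroundPropagators, Thm 3.11 p.416] -/
theorem posDefTr_readback_laplaceA {U₀ : GaugeField (F.P K) 0 (Matrix.specialUnitaryGroup (Fin 2) ℂ)} (hp : PosOnto F n K h c₀ cB a Δx U₀) :
    PosDefTr (fun _ => (1 : ℝ)) ((toL2 F K c₀).symm.toLinearMap ∘ₗ laplaceA F n K h c₀ cB a Δx U₀ ∘ₗ (toL2 F K c₀).toLinearMap) := by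
  intro Φ hΦ
  have hc : (0 : ℝ) < c₀ := Fact.out
  have hx : toL2 F K c₀ Φ ≠ 0 := fun h0 => hΦ ((toL2 F K c₀).injective (by rw [h0, map_zero]))
  have hpos := hp.pos (toL2 F K c₀ Φ) hx
  rw [RCLike.re_to_complex] at hpos
  have h1 := re_inner_toL2_eq_trIP (c₀ := c₀) Φ ((toL2 F K c₀).symm (laplaceA F n K h c₀ cB a Δx U₀ (toL2 F K c₀ Φ)))
  rw [LinearEquiv.apply_symm_apply, trIP_const_eq_mul] at h1
  simp only [LinearMap.coe_comp, LinearEquiv.coe_coe, Function.comp_apply]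
  exact pos_of_mul_pos_right (h1 ▸ hpos) hc.le

/-! ## §3 The ten operator identities on the route carrier (✓A transported by ✓B §1) -/

/-- `invG0'` on the route carrier: `(toL2⁻¹ G toL2) ∘ (toL2⁻¹ Δ_a toL2) = id` ON THE CLASS. [cite: Balaban1985BackgroundPropagators, (3.27) p.395] -/
theorem readback_GT_comp_laplaceA {U₀ : GaugeField (F.P K) 0 (Matrix.specialUnitaryGroup (Fin 2) ℂ)} (hp : PosOnto F n K h c₀ cB a Δx U₀) :
    ((toL2 F K c₀).symm.toLinearMap ∘ₗ GT F n K h c₀ cB a Δx U₀ ∘ₗ (toL2 F K c₀).toLinearMap) ∘ₗ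
        ((toL2 F K c₀).symm.toLinearMap ∘ₗ laplaceA F n K h c₀ cB a Δx U₀ ∘ₗ (toL2 F K c₀).toLinearMap) = LinearMap.id := by
  rw [transport_comp_transport, GT_comp_laplaceA hp, transport_id]

/-- `invG` on the route carrier: `(toL2⁻¹ Δ_a[Δ0x] toL2 − toL2⁻¹ (Δ0x − Δπx) toL2) ∘ (toL2⁻¹ G[Δπx] toL2) = id` ON THE CLASS. [cite: Balaban1985BackgroundPropagators, (3.120)–(3.122) pp.419–420] -/
theorem readback_invG {U₀ : GaugeField (F.P K) 0 (Matrix.specialUnitaryGroup (Fin 2) ℂ)} (hp : PosOnto F n K h c₀ cB a Δπx U₀) :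
    (((toL2 F K c₀).symm.toLinearMap ∘ₗ laplaceA F n K h c₀ cB a Δ0x U₀ ∘ₗ (toL2 F K c₀).toLinearMap) -
        ((toL2 F K c₀).symm.toLinearMap ∘ₗ (Δ0x U₀ - Δπx U₀) ∘ₗ (toL2 F K c₀).toLinearMap)) ∘ₗ
      ((toL2 F K c₀).symm.toLinearMap ∘ₗ GT F n K h c₀ cB a Δπx U₀ ∘ₗ (toL2 F K c₀).toLinearMap) = LinearMap.id := by
  rw [← transport_sub, transport_comp_transport, invG_row hp, transport_id]

/-- `invG1` on the route carrier. [cite: Balaban1985BackgroundPropagators, (3.128) p.421, (3.134) p.422] -/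
theorem readback_invG1 {U₀ : GaugeField (F.P K) 0 (Matrix.specialUnitaryGroup (Fin 2) ℂ)} (hp : PosOnto F n K h c₀ cB a Δ1x U₀) :
    (((toL2 F K c₀).symm.toLinearMap ∘ₗ laplaceA F n K h c₀ cB a Δ0x U₀ ∘ₗ (toL2 F K c₀).toLinearMap) -
        (((toL2 F K c₀).symm.toLinearMap ∘ₗ (Δ0x U₀ - Δπx U₀) ∘ₗ (toL2 F K c₀).toLinearMap) +
          ((toL2 F K c₀).symm.toLinearMap ∘ₗ (Δπx U₀ - Δ1x U₀) ∘ₗ (toL2 F K c₀).toLinearMap))) ∘ₗ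
      ((toL2 F K c₀).symm.toLinearMap ∘ₗ GT F n K h c₀ cB a Δ1x U₀ ∘ₗ (toL2 F K c₀).toLinearMap) = LinearMap.id := by
  rw [← transport_add, ← transport_sub, transport_comp_transport, invG1_row hp, transport_id]

/-- `eq126`∕`eq129` on the route carrier: `toL2⁻¹ H toL2B = (toL2⁻¹ G toL2) ∘ (toL2⁻¹ Q† toL2B) ∘ (toL2B⁻¹ (QGQ*)⁻¹ toL2B)` ON THE CLASS. [cite: Balaban1985BackgroundPropagators, (3.126) p.420, (3.129) p.421] -/
theorem readback_HT_eq_comp {U₀ : GaugeField (F.P K) 0 (Matrix.specialUnitaryGroup (Fin 2) ℂ)} (hp : PosOnto F n K h c₀ cB a Δx U₀) :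
    (toL2 F K c₀).symm.toLinearMap ∘ₗ HT F n K h c₀ cB a Δx U₀ ∘ₗ (toL2B F n cB).toLinearMap =
      ((toL2 F K c₀).symm.toLinearMap ∘ₗ GT F n K h c₀ cB a Δx U₀ ∘ₗ (toL2 F K c₀).toLinearMap) ∘ₗ
        ((toL2 F K c₀).symm.toLinearMap ∘ₗ LinearMap.adjoint (Qk F n K h c₀ cB U₀) ∘ₗ (toL2B F n cB).toLinearMap) ∘ₗ
          ((toL2B F n cB).symm.toLinearMap ∘ₗ KinvT F n K h c₀ cB a Δx U₀ ∘ₗ (toL2B F n cB).toLinearMap) := by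
  rw [transport_comp_transport, transport_comp_transport, ← HT_eq_comp hp]

/-- `eq153` on the route carrier, hypothesis-free: `toL2⁻¹ 𝔊 toL2 = (toL2⁻¹ G toL2) ∘ (1 − Q†C Q G − D R D* G)` with every letter read back. [cite: Balaban1985BackgroundPropagators, (3.153) p.426] -/
theorem readback_frakGT_eq (U₀ : GaugeField (F.P K) 0 (Matrix.specialUnitaryGroup (Fin 2) ℂ)) :
    (toL2 F K c₀).symm.toLinearMap ∘ₗ frakGT F n K h c₀ cB a Δx U₀ ∘ₗ (toL2 F K c₀).toLinearMap =
      ((toL2 F K c₀).symm.toLinearMap ∘ₗ GT F n K h c₀ cB a Δx U₀ ∘ₗ (toL2 F K c₀).toLinearMap) ∘ₗ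
        (LinearMap.id -
          ((toL2 F K c₀).symm.toLinearMap ∘ₗ LinearMap.adjoint (Qk F n K h c₀ cB U₀) ∘ₗ (toL2B F n cB).toLinearMap) ∘ₗ
            ((toL2B F n cB).symm.toLinearMap ∘ₗ KinvT F n K h c₀ cB a Δx U₀ ∘ₗ (toL2B F n cB).toLinearMap) ∘ₗ
              ((toL2B F n cB).symm.toLinearMap ∘ₗ Qk F n K h c₀ cB U₀ ∘ₗ (toL2 F K c₀).toLinearMap) ∘ₗ
                ((toL2 F K c₀).symm.toLinearMap ∘ₗ GT F n K h c₀ cB a Δx U₀ ∘ₗ (toL2 F K c₀).toLinearMap) -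
          ((toL2 F K c₀).symm.toLinearMap ∘ₗ DL2 F n K c₀ U₀ ∘ₗ (toL2S F K c₀).toLinearMap) ∘ₗ
            ((toL2S F K c₀).symm.toLinearMap ∘ₗ RS F n K h c₀ cB U₀ ∘ₗ (toL2S F K c₀).toLinearMap) ∘ₗ
              ((toL2S F K c₀).symm.toLinearMap ∘ₗ DstarL2 F n K c₀ U₀ ∘ₗ (toL2 F K c₀).toLinearMap) ∘ₗ
                ((toL2 F K c₀).symm.toLinearMap ∘ₗ GT F n K h c₀ cB a Δx U₀ ∘ₗ (toL2 F K c₀).toLinearMap)) := by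
  rw [transport_comp_transport, transport_comp_transport, transport_comp_transport, transport_comp_transport, transport_comp_transport, transport_comp_transport,
    ← transport_id (toL2 F K c₀), ← transport_sub, ← transport_sub, transport_comp_transport, ← frakGT_eq]

/-- `c1_inv` on the route carrier ON THE CLASS. [cite: Balaban1985BackgroundPropagators, (3.126) p.420] -/
theorem readback_c1_inv {U₀ : GaugeField (F.P K) 0 (Matrix.specialUnitaryGroup (Fin 2) ℂ)} (hp : PosOnto F n K h c₀ cB a Δx U₀) :
    ((toL2B F n cB).symm.toLinearMap ∘ₗ Qk F n K h c₀ cB U₀ ∘ₗ (toL2 F K c₀).toLinearMap) ∘ₗ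
        ((toL2 F K c₀).symm.toLinearMap ∘ₗ GT F n K h c₀ cB a Δx U₀ ∘ₗ (toL2 F K c₀).toLinearMap) ∘ₗ
          ((toL2 F K c₀).symm.toLinearMap ∘ₗ LinearMap.adjoint (Qk F n K h c₀ cB U₀) ∘ₗ (toL2B F n cB).toLinearMap) ∘ₗ
            ((toL2B F n cB).symm.toLinearMap ∘ₗ KinvT F n K h c₀ cB a Δx U₀ ∘ₗ (toL2B F n cB).toLinearMap) = LinearMap.id := by
  rw [transport_comp_transport, transport_comp_transport, transport_comp_transport, c1_inv_row hp, transport_id]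

/-- `h124Q` on the route carrier ON THE CLASS (slot kills `D N_S`). [cite: Balaban1985BackgroundPropagators, (3.124) p.420] -/
theorem readback_h124Q {U₀ : GaugeField (F.P K) 0 (Matrix.specialUnitaryGroup (Fin 2) ℂ)} (hp : PosOnto F n K h c₀ cB a Δx U₀)
    (hΔ : ∀ l ∈ NS F n K h c₀ cB U₀, Δx U₀ (DL2 F n K c₀ U₀ l) = 0) :
    ((toL2B F n cB).symm.toLinearMap ∘ₗ Qk F n K h c₀ cB U₀ ∘ₗ (toL2 F K c₀).toLinearMap) ∘ₗ
        ((toL2 F K c₀).symm.toLinearMap ∘ₗ GT F n K h c₀ cB a Δx U₀ ∘ₗ (toL2 F K c₀).toLinearMap) ∘ₗ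
          ((toL2 F K c₀).symm.toLinearMap ∘ₗ DL2 F n K c₀ U₀ ∘ₗ (toL2S F K c₀).toLinearMap) ∘ₗ
            ((toL2S F K c₀).symm.toLinearMap ∘ₗ RS F n K h c₀ cB U₀ ∘ₗ (toL2S F K c₀).toLinearMap) = 0 := by
  rw [transport_comp_transport, transport_comp_transport, transport_comp_transport, h124Q_row hp hΔ, transport_zero]

/-- `h124R` on the route carrier ON THE CLASS (slot symmetric and killing `D N_S`). [cite: Balaban1985BackgroundPropagators, (3.124) p.420] -/
theorem readback_h124R {U₀ : GaugeField (F.P K) 0 (Matrix.specialUnitaryGroup (Fin 2) ℂ)} (hp : PosOnto F n K h c₀ cB a Δx U₀) (hΔs : (Δx U₀).IsSymmetric)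
    (hΔ : ∀ l ∈ NS F n K h c₀ cB U₀, Δx U₀ (DL2 F n K c₀ U₀ l) = 0) :
    ((toL2S F K c₀).symm.toLinearMap ∘ₗ RS F n K h c₀ cB U₀ ∘ₗ (toL2S F K c₀).toLinearMap) ∘ₗ
        ((toL2S F K c₀).symm.toLinearMap ∘ₗ DstarL2 F n K c₀ U₀ ∘ₗ (toL2 F K c₀).toLinearMap) ∘ₗ
          ((toL2 F K c₀).symm.toLinearMap ∘ₗ GT F n K h c₀ cB a Δx U₀ ∘ₗ (toL2 F K c₀).toLinearMap) ∘ₗ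
            ((toL2 F K c₀).symm.toLinearMap ∘ₗ LinearMap.adjoint (Qk F n K h c₀ cB U₀) ∘ₗ (toL2B F n cB).toLinearMap) = 0 := by
  rw [transport_comp_transport, transport_comp_transport, transport_comp_transport, h124R_row hp hΔs hΔ, transport_zero]

/-- `hR` on the route carrier ON THE CLASS. [cite: Balaban1985BackgroundPropagators, (3.124) p.420, (3.147) p.425] -/
theorem readback_hR {U₀ : GaugeField (F.P K) 0 (Matrix.specialUnitaryGroup (Fin 2) ℂ)} (hp : PosOnto F n K h c₀ cB a Δx U₀)
    (hΔ : ∀ l ∈ NS F n K h c₀ cB U₀, Δx U₀ (DL2 F n K c₀ U₀ l) = 0) :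
    ((toL2S F K c₀).symm.toLinearMap ∘ₗ RS F n K h c₀ cB U₀ ∘ₗ (toL2S F K c₀).toLinearMap) ∘ₗ
        ((toL2S F K c₀).symm.toLinearMap ∘ₗ DstarL2 F n K c₀ U₀ ∘ₗ (toL2 F K c₀).toLinearMap) ∘ₗ
          ((toL2 F K c₀).symm.toLinearMap ∘ₗ GT F n K h c₀ cB a Δx U₀ ∘ₗ (toL2 F K c₀).toLinearMap) ∘ₗ
            ((toL2 F K c₀).symm.toLinearMap ∘ₗ DL2 F n K c₀ U₀ ∘ₗ (toL2S F K c₀).toLinearMap) ∘ₗ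
              ((toL2S F K c₀).symm.toLinearMap ∘ₗ RS F n K h c₀ cB U₀ ∘ₗ (toL2S F K c₀).toLinearMap) =
      (toL2S F K c₀).symm.toLinearMap ∘ₗ RS F n K h c₀ cB U₀ ∘ₗ (toL2S F K c₀).toLinearMap := by
  rw [transport_comp_transport, transport_comp_transport, transport_comp_transport, transport_comp_transport, hR_row hp hΔ]

end Summit.QuantumFields.YangMills.Theorems.Prop7SectET3OpsT3CarrierRows

end
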